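import Mathlib
import Summits.KontsevichZagierPeriods.KontsevichZagierPeriods.Theorems.SoloInformedTelescopeStepMoves
import HarnessLib
import HarnessLib.Audit

/-!
# SoloInformed — the weight-4 telescope step `𝕁(Q = x₁x₂)` (PART XVI, towards the sum formula)

Solo programme `solo-KontsevichZagierPeriods-informed`, session s45. The generic Möbius telescope
step (`SoloInformedTelDatum.telescope`) instantiated in dimension `4` with active coordinate `x₀`,
`Q = x₁x₂`, `ω = x₃`, `C = 1`, cylinder `D = (0,1)⁴`:

  `[(0,1)⁴ ∩ {x₃ < x₀}, 1/((1 − x₀x₁x₂)(1 − x₃))] − [(0,1)⁴, 1/((1 − x₀x₁x₂)(1 − x₀x₁x₂x₃))] ∈ relations`.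

The left side is the Yamamoto integral of the garland poset of `ζ(1,3)`-type (it decomposes into
`Z(2,2) + 2 Z(1,3)`), the right side is `ζ⋆(1,3) = ζ(1,3) + ζ(4)` in cubical coordinates; the
decompositions are carried out in `SoloInformedZetaFour*`. This file: product weights `W_e` in any
dimension with the domination criterion, continuity of the step integrands, the two dominations
`f₁ ≤ W_{(3/4,1/2,0,3/4)}` on `{x₃ < x₀}` and `S ≤ W_{(1/2,1/2,1/2,1/2)}`, and the datum
`soloInformedZ4Datum : SoloInformedTelDatum 4` with its telescope identity.

References: Kontsevich–Zagier 2001 §1.2 [KontsevichZagier2001]; S. Yamamoto, arXiv:1405.6499;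
M. Kaneko, S. Yamamoto, arXiv:1605.03117.
-/

noncomputable section

open MeasureTheory Set MvPolynomial
open Literature.ModelTheory.ExponentialFields Literature.NumberTheory.Transcendental
open Literature.NumberTheory.Transcendental.KZ

namespace Summit.KontsevichZagierPeriods.KontsevichZagierPeriods.Theorems

/-! ## 1. Product weights in any dimension -/

/-- The weight `W_e(x) = ∏ᵢ (1 − xᵢ)^{−eᵢ}` on `ℝᵐ`. -/
def soloInformedW {m : ℕ} (e : Fin m → ℝ) (x : Fin m → ℝ) : ℝ := ∏ i, (1 - x i) ^ (-(e i))

/-- The weight is positive on the open cube. -/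
theorem soloInformedW_pos {m : ℕ} (e : Fin m → ℝ) {x : Fin m → ℝ} (hx : x ∈ soloInformedOpenCube m) :
    0 < soloInformedW e x :=
  Finset.prod_pos fun i _ => Real.rpow_pos_of_pos (by linarith [(hx i).2]) _

/-- **`W_e` is integrable on `(0,1)ᵐ` when every `eᵢ < 1`.** [folklore] -/
theorem soloInformed_integrableOn_W {m : ℕ} (e : Fin m → ℝ) (he : ∀ i, e i < 1) :
    IntegrableOn (soloInformedW e) (soloInformedOpenCube m) := by
  have h : Integrable (fun x : Fin m → ℝ => ∏ i, (1 - x i) ^ (-(e i)))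
      (Measure.pi fun _ : Fin m => (volume : Measure ℝ).restrict (Ioo (0 : ℝ) 1)) :=
    Integrable.fintype_prod (f := fun i (t : ℝ) => (1 - t) ^ (-(e i)))
      fun i => soloInformed_integrable_Ioo_one_sub_rpow (he i)
  rw [IntegrableOn, soloInformedOpenCube_eq_pi, volume_pi, Measure.restrict_pi_pi]
  exact h

/-- The open cube `(0,1)ᵐ` is measurable. -/
theorem soloInformed_measurableSet_openCube (m : ℕ) : MeasurableSet (soloInformedOpenCube m) := by
  rw [soloInformedOpenCube_eq_pi]
  exact MeasurableSet.univ_pi fun _ => measurableSet_Ioo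

/-- **Domination criterion** in any dimension: continuous on a measurable `D ⊆ (0,1)ᵐ` and bounded
by `C · W_e` with all `eᵢ < 1` implies integrable on `D`. [folklore] -/
theorem soloInformed_integrableOn_of_le_W {m : ℕ} {D : Set (Fin m → ℝ)} (hD : MeasurableSet D)
    (hDc : D ⊆ soloInformedOpenCube m) {f : (Fin m → ℝ) → ℝ} (hf : ContinuousOn f D)
    (e : Fin m → ℝ) (he : ∀ i, e i < 1) (C : ℝ)
    (hle : ∀ x ∈ D, |f x| ≤ C * soloInformedW e x) : IntegrableOn f D := by
  have hW : IntegrableOn (fun x => C * soloInformedW e x) D :=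
    ((soloInformed_integrableOn_W e he).mono_set hDc).const_mul C
  refine Integrable.mono' hW (hf.aestronglyMeasurable hD) ?_
  exact (ae_restrict_iff' hD).2 (ae_of_all _ fun x hx => by
    simpa [Real.norm_eq_abs] using hle x hx)

/-- The weight in dimension `4`, written out. -/
theorem soloInformedW_eq4 (e x : Fin 4 → ℝ) : soloInformedW e x =
    (1 - x 0) ^ (-(e 0)) * (1 - x 1) ^ (-(e 1)) * (1 - x 2) ^ (-(e 2)) * (1 - x 3) ^ (-(e 3)) := by
  simp [soloInformedW, Fin.prod_univ_four]

/-! ## 2. Continuity of the step integrands -/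

/-- Polynomial functions are continuous (the tree's `SoloInformedSubgraph.lean` has the same lemma as
`soloInformed_continuous_aeval`; restated here to keep the import closure small). -/
theorem soloInformed_continuous_aevalT {m : ℕ} (p : MvPolynomial (Fin m) ℚ) :
    Continuous fun x : Fin m → ℝ => (aeval x p : ℝ) :=
  continuous_iff_continuousAt.2 fun x => (soloInformed_hasFDerivAt_aeval p x).continuousAt

/-- Auxiliary (weight-4 telescope): `soloInformed_continuousOn_stepF1`. -/
theorem soloInformed_continuousOn_stepF1 {m : ℕ} (i : Fin m) (Q Ω C : MvPolynomial (Fin m) ℚ)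
    {D : Set (Fin m → ℝ)}
    (hD : ∀ x ∈ D, (aeval x C : ℝ) * (1 - aeval x Q * x i) * (1 - aeval x Ω) ≠ 0) :
    ContinuousOn (soloInformedStepF1 i Q Ω C) D := by
  have hc : Continuous fun x : Fin m → ℝ =>
      (aeval x C : ℝ) * (1 - aeval x Q * x i) * (1 - aeval x Ω) :=
    ((soloInformed_continuous_aevalT C).mul (continuous_const.sub
      ((soloInformed_continuous_aevalT Q).mul (continuous_apply i)))).mul
      (continuous_const.sub (soloInformed_continuous_aevalT Ω))
  exact continuousOn_const.div hc.continuousOn hD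

/-- Auxiliary (weight-4 telescope): `soloInformed_continuousOn_stepFS`. -/
theorem soloInformed_continuousOn_stepFS {m : ℕ} (i : Fin m) (Q Ω C : MvPolynomial (Fin m) ℚ)
    {D : Set (Fin m → ℝ)}
    (hD : ∀ x ∈ D, (aeval x C : ℝ) * (1 - aeval x Q * x i) * (1 - aeval x Q * x i * aeval x Ω) ≠ 0) :
    ContinuousOn (soloInformedStepFS i Q Ω C) D := by
  have hc : Continuous fun x : Fin m → ℝ =>
      (aeval x C : ℝ) * (1 - aeval x Q * x i) * (1 - aeval x Q * x i * aeval x Ω) :=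
    ((soloInformed_continuous_aevalT C).mul (continuous_const.sub
      ((soloInformed_continuous_aevalT Q).mul (continuous_apply i)))).mul
      (continuous_const.sub (((soloInformed_continuous_aevalT Q).mul (continuous_apply i)).mul
        (soloInformed_continuous_aevalT Ω)))
  exact continuousOn_const.div hc.continuousOn hD

/-! ## 3. The weight-4 datum: `i = 0`, `Q = X₁X₂`, `ω = X₃`, `C = 1`, `D = (0,1)⁴` -/

/-- `Q = X₁ X₂`. -/
def soloInformedZ4Q : MvPolynomial (Fin 4) ℚ := X 1 * X 2
/-- `ω = X₃`. -/
def soloInformedZ4Ω : MvPolynomial (Fin 4) ℚ := X 3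

/-- Auxiliary (weight-4 telescope): `soloInformed_aeval_Z4Q`. -/
@[simp] theorem soloInformed_aeval_Z4Q (x : Fin 4 → ℝ) : (aeval x soloInformedZ4Q : ℝ) = x 1 * x 2 := by
  simp [soloInformedZ4Q]
/-- Auxiliary (weight-4 telescope): `soloInformed_aeval_Z4Ω`. -/
@[simp] theorem soloInformed_aeval_Z4Ω (x : Fin 4 → ℝ) : (aeval x soloInformedZ4Ω : ℝ) = x 3 := by
  simp [soloInformedZ4Ω]

/-- `f₁ = 1/((1 − x₁x₂x₀)(1 − x₃))`. -/
theorem soloInformed_Z4F1_eq (x : Fin 4 → ℝ) :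
    soloInformedStepF1 0 soloInformedZ4Q soloInformedZ4Ω 1 x = 1 / ((1 - x 1 * x 2 * x 0) * (1 - x 3)) := by
  simp [soloInformedStepF1]

/-- `S = 1/((1 − x₁x₂x₀)(1 − x₁x₂x₀x₃))`. -/
theorem soloInformed_Z4FS_eq (x : Fin 4 → ℝ) :
    soloInformedStepFS 0 soloInformedZ4Q soloInformedZ4Ω 1 x =
      1 / ((1 - x 1 * x 2 * x 0) * (1 - x 1 * x 2 * x 0 * x 3)) := by
  simp [soloInformedStepFS]

/-- The exponents dominating `f₁` on `{x₃ < x₀}`. -/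
def soloInformedZ4E1 : Fin 4 → ℝ := ![3 / 4, 1 / 2, 0, 3 / 4]
/-- The exponents dominating `S`. -/
def soloInformedZ4E2 : Fin 4 → ℝ := ![1 / 2, 1 / 2, 1 / 2, 1 / 2]

/-- Auxiliary (weight-4 telescope): `soloInformedZ4E1_zero`. -/
@[simp] theorem soloInformedZ4E1_zero : soloInformedZ4E1 0 = 3 / 4 := rfl
/-- Auxiliary (weight-4 telescope): `soloInformedZ4E1_one`. -/
@[simp] theorem soloInformedZ4E1_one : soloInformedZ4E1 1 = 1 / 2 := rfl
/-- Auxiliary (weight-4 telescope): `soloInformedZ4E1_two`. -/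
@[simp] theorem soloInformedZ4E1_two : soloInformedZ4E1 2 = 0 := rfl
/-- Auxiliary (weight-4 telescope): `soloInformedZ4E1_three`. -/
@[simp] theorem soloInformedZ4E1_three : soloInformedZ4E1 3 = 3 / 4 := rfl
/-- Auxiliary (weight-4 telescope): `soloInformedZ4E2_apply`. -/
@[simp] theorem soloInformedZ4E2_apply (j : Fin 4) : soloInformedZ4E2 j = 1 / 2 := by
  fin_cases j <;> rfl

/-- Auxiliary (weight-4 telescope): `soloInformedZ4E1_lt_one`. -/
theorem soloInformedZ4E1_lt_one (j : Fin 4) : soloInformedZ4E1 j < 1 := by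
  fin_cases j <;> simp <;> norm_num
/-- Auxiliary (weight-4 telescope): `soloInformedZ4E2_lt_one`. -/
theorem soloInformedZ4E2_lt_one (j : Fin 4) : soloInformedZ4E2 j < 1 := by
  simp; norm_num

/-- `0 < 1 − x₁x₂x₀` on the cube. -/
theorem soloInformed_Z4_one_sub_pos {x : Fin 4 → ℝ} (hx : x ∈ soloInformedOpenCube 4) :
    0 < 1 - x 1 * x 2 * x 0 := by
  have h0 := hx 0; have h1 := hx 1; have h2 := hx 2
  have h12 : x 1 * x 2 < 1 := by nlinarith [mul_pos h1.1 h2.1]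
  nlinarith [mul_pos (mul_pos h1.1 h2.1) h0.1]

/-- `0 < 1 − x₁x₂x₀x₃` on the cube. -/
theorem soloInformed_Z4_one_sub_pos' {x : Fin 4 → ℝ} (hx : x ∈ soloInformedOpenCube 4) :
    0 < 1 - x 1 * x 2 * x 0 * x 3 := by
  have h3 := hx 3
  have h := soloInformed_Z4_one_sub_pos hx
  have hp : 0 < x 1 * x 2 * x 0 := mul_pos (mul_pos (hx 1).1 (hx 2).1) (hx 0).1
  nlinarith [mul_pos hp h3.1]

/-- **Domination of `f₁` on `{x₃ < x₀}`**: `f₁ ≤ (1−x₀)^{−3/4}(1−x₁)^{−1/2}(1−x₃)^{−3/4}`. -/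
theorem soloInformed_Z4F1_le_W {x : Fin 4 → ℝ} (hx : x ∈ soloInformedOpenCube 4) (h30 : x 3 < x 0) :
    1 / ((1 - x 1 * x 2 * x 0) * (1 - x 3)) ≤ soloInformedW soloInformedZ4E1 x := by
  have h0 := hx 0; have h1 := hx 1; have h2 := hx 2; have h3 := hx 3
  have hp1 := soloInformed_one_div_one_sub_mul_le (α := 1 / 2) (β := 1 / 2) h0.1.le h0.2 h1.1.le
    h1.2 (by norm_num) (by norm_num) (by norm_num)
  have hred : 1 / (1 - x 1 * x 2 * x 0) ≤ 1 / (1 - x 0 * x 1) := by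
    refine one_div_le_one_div_of_le (by nlinarith [mul_pos h0.1 h1.1]) ?_
    nlinarith [mul_nonneg (mul_nonneg h0.1.le h1.1.le) h2.1.le, mul_nonneg h0.1.le h1.1.le]
  have hsplit : 1 / (1 - x 3) = (1 - x 3) ^ (-(3 / 4 : ℝ)) * (1 - x 3) ^ (-(1 / 4 : ℝ)) := by
    rw [soloInformed_one_div_eq_rpow_neg_one h3.2, ← soloInformed_rpow_neg_add h3.2]; norm_num
  have hmono : (1 - x 3) ^ (-(1 / 4 : ℝ)) ≤ (1 - x 0) ^ (-(1 / 4 : ℝ)) :=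
    soloInformed_rpow_neg_antitone h0.2 h30.le (by norm_num)
  have hc : 0 ≤ (1 - x 3) ^ (-(3 / 4 : ℝ)) := Real.rpow_nonneg (by linarith) _
  have hu : (1 - x 0) ^ (-(3 / 4 : ℝ)) = (1 - x 0) ^ (-(1 / 2 : ℝ)) * (1 - x 0) ^ (-(1 / 4 : ℝ)) := by
    rw [← soloInformed_rpow_neg_add h0.2]; norm_num
  calc 1 / ((1 - x 1 * x 2 * x 0) * (1 - x 3)) = 1 / (1 - x 1 * x 2 * x 0) * (1 / (1 - x 3)) := by
        rw [one_div_mul_one_div]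
    _ ≤ (1 - x 0) ^ (-(1 / 2 : ℝ)) * (1 - x 1) ^ (-(1 / 2 : ℝ)) *
        ((1 - x 3) ^ (-(3 / 4 : ℝ)) * (1 - x 0) ^ (-(1 / 4 : ℝ))) := by
        refine mul_le_mul (hred.trans hp1) ?_ (one_div_pos.2 (by linarith)).le
          (mul_nonneg (Real.rpow_nonneg (by linarith) _) (Real.rpow_nonneg (by linarith) _))
        rw [hsplit]
        exact mul_le_mul_of_nonneg_left hmono hc
    _ = soloInformedW soloInformedZ4E1 x := by
        rw [soloInformedW_eq4, soloInformedZ4E1_zero, soloInformedZ4E1_one, soloInformedZ4E1_two,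
          soloInformedZ4E1_three, hu, neg_zero, Real.rpow_zero]; ring

/-- **Domination of `S`**: `S ≤ ∏ (1−xⱼ)^{−1/2}`. -/
theorem soloInformed_Z4FS_le_W {x : Fin 4 → ℝ} (hx : x ∈ soloInformedOpenCube 4) :
    1 / ((1 - x 1 * x 2 * x 0) * (1 - x 1 * x 2 * x 0 * x 3)) ≤ soloInformedW soloInformedZ4E2 x := by
  have h0 := hx 0; have h1 := hx 1; have h2 := hx 2; have h3 := hx 3
  have hp1 := soloInformed_one_div_one_sub_mul_le (α := 1 / 2) (β := 1 / 2) h0.1.le h0.2 h1.1.le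
    h1.2 (by norm_num) (by norm_num) (by norm_num)
  have hp2 := soloInformed_one_div_one_sub_mul_le (α := 1 / 2) (β := 1 / 2) h2.1.le h2.2 h3.1.le
    h3.2 (by norm_num) (by norm_num) (by norm_num)
  have hred1 : 1 / (1 - x 1 * x 2 * x 0) ≤ 1 / (1 - x 0 * x 1) := by
    refine one_div_le_one_div_of_le (by nlinarith [mul_pos h0.1 h1.1]) ?_
    nlinarith [mul_nonneg (mul_nonneg h0.1.le h1.1.le) h2.1.le, mul_nonneg h0.1.le h1.1.le]
  have hred2 : 1 / (1 - x 1 * x 2 * x 0 * x 3) ≤ 1 / (1 - x 2 * x 3) := by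
    refine one_div_le_one_div_of_le (by nlinarith [mul_pos h2.1 h3.1]) ?_
    nlinarith [mul_nonneg (mul_nonneg h2.1.le h3.1.le) (mul_nonneg h0.1.le h1.1.le),
      mul_nonneg h2.1.le h3.1.le, mul_le_one₀ h0.2.le h1.1.le h1.2.le]
  calc 1 / ((1 - x 1 * x 2 * x 0) * (1 - x 1 * x 2 * x 0 * x 3))
        = 1 / (1 - x 1 * x 2 * x 0) * (1 / (1 - x 1 * x 2 * x 0 * x 3)) := by
        rw [one_div_mul_one_div]
    _ ≤ (1 - x 0) ^ (-(1 / 2 : ℝ)) * (1 - x 1) ^ (-(1 / 2 : ℝ)) *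
        ((1 - x 2) ^ (-(1 / 2 : ℝ)) * (1 - x 3) ^ (-(1 / 2 : ℝ))) :=
        mul_le_mul (hred1.trans hp1) (hred2.trans hp2)
          (one_div_pos.2 (soloInformed_Z4_one_sub_pos' hx)).le
          (mul_nonneg (Real.rpow_nonneg (by linarith) _) (Real.rpow_nonneg (by linarith) _))
    _ = soloInformedW soloInformedZ4E2 x := by
        rw [soloInformedW_eq4]; simp only [soloInformedZ4E2_apply]; ring

/-- The domain of the left side: `(0,1)⁴ ∩ {x₃ < x₀}`. -/
theorem soloInformed_Z4D1_eq : soloInformedOpenCube 4 ∩ {x : Fin 4 → ℝ | (aeval x soloInformedZ4Ω : ℝ) < x 0}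
    = soloInformedOpenCube 4 ∩ {x | x 3 < x 0} := by
  ext x; simp

/-- Auxiliary (weight-4 telescope): `soloInformed_measurableSet_Z4D1`. -/
theorem soloInformed_measurableSet_Z4D1 :
    MeasurableSet (soloInformedOpenCube 4 ∩ {x : Fin 4 → ℝ | x 3 < x 0}) :=
  (soloInformed_measurableSet_openCube 4).inter
    (measurableSet_lt (measurable_pi_apply 3) (measurable_pi_apply 0))

/-- Integrability of `f₁` on `(0,1)⁴ ∩ {x₃ < x₀}`. -/
theorem soloInformed_integrableOn_Z4F1 :
    IntegrableOn (soloInformedStepF1 0 soloInformedZ4Q soloInformedZ4Ω 1)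
      (soloInformedOpenCube 4 ∩ {x : Fin 4 → ℝ | (aeval x soloInformedZ4Ω : ℝ) < x 0}) := by
  rw [soloInformed_Z4D1_eq]
  refine soloInformed_integrableOn_of_le_W soloInformed_measurableSet_Z4D1 inter_subset_left
    (soloInformed_continuousOn_stepF1 0 _ _ _ fun x hx => ?_) soloInformedZ4E1
    soloInformedZ4E1_lt_one 1 fun x hx => ?_
  · have h := soloInformed_Z4_one_sub_pos hx.1
    have h3 := hx.1 3
    simpa using (mul_pos h (by linarith : (0:ℝ) < 1 - x 3)).ne'
  · rw [soloInformed_Z4F1_eq, one_mul, abs_of_pos (one_div_pos.2 (mul_pos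
      (soloInformed_Z4_one_sub_pos hx.1) (by linarith [(hx.1 3).2])))]
    exact soloInformed_Z4F1_le_W hx.1 hx.2

/-- Integrability of `S` on `(0,1)⁴`. -/
theorem soloInformed_integrableOn_Z4FS :
    IntegrableOn (soloInformedStepFS 0 soloInformedZ4Q soloInformedZ4Ω 1) (soloInformedOpenCube 4) := by
  refine soloInformed_integrableOn_of_le_W (soloInformed_measurableSet_openCube 4) subset_rfl
    (soloInformed_continuousOn_stepFS 0 _ _ _ fun x hx => ?_) soloInformedZ4E2
    soloInformedZ4E2_lt_one 1 fun x hx => ?_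
  · simpa using (mul_pos (soloInformed_Z4_one_sub_pos hx) (soloInformed_Z4_one_sub_pos' hx)).ne'
  · rw [soloInformed_Z4FS_eq, one_mul, abs_of_pos (one_div_pos.2 (mul_pos
      (soloInformed_Z4_one_sub_pos hx) (soloInformed_Z4_one_sub_pos' hx)))]
    exact soloInformed_Z4FS_le_W hx

/-- **The weight-4 telescope datum** `(i, Q, ω, C, D) = (0, X₁X₂, X₃, 1, (0,1)⁴)`. -/
def soloInformedZ4Datum : SoloInformedTelDatum 4 where
  i := 0
  Q := soloInformedZ4Q
  Ω := soloInformedZ4Ω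
  C := 1
  D := soloInformedOpenCube 4
  isSemialgebraic_D := isSemialgebraic_soloInformedOpenCube 4
  measurableSet_D := soloInformed_measurableSet_openCube 4
  update_mem := fun x hx t ht0 ht1 j => by
    by_cases hj : j = 0
    · subst hj; simpa using ⟨ht0, ht1⟩
    · rw [Function.update_of_ne hj]; exact hx j
  mem_Ioo := fun x hx => hx 0
  vars_Q := fun h => by
    have hm := (vars_mul (X 1 : MvPolynomial (Fin 4) ℚ) (X 2)) h
    simp [vars_X] at hm
  vars_Ω := by simp [soloInformedZ4Ω, vars_X]
  vars_C := by simp [vars_one]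
  Q_bound := fun x hx => by
    have h1 := hx 1; have h2 := hx 2
    simp only [soloInformed_aeval_Z4Q]
    exact ⟨(mul_pos h1.1 h2.1).le, by nlinarith [mul_pos h1.1 h2.1]⟩
  Ω_bound := fun x hx => by simpa using hx 3
  C_pos := fun x _ => by simp
  integrableOn_F1 := soloInformed_integrableOn_Z4F1
  integrableOn_FS := soloInformed_integrableOn_Z4FS

/-- **THE WEIGHT-4 STEP (KERNEL):**
`[(0,1)⁴ ∩ {x₃ < x₀}, 1/((1 − x₀x₁x₂)(1 − x₃))] − [(0,1)⁴, 1/((1 − x₀x₁x₂)(1 − x₀x₁x₂x₃))] ∈ relations`. -/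
theorem soloInformed_z4_telescope :
    of soloInformedZ4Datum.R1 - of soloInformedZ4Datum.R2 ∈ relations :=
  soloInformedZ4Datum.telescope

/-- Auxiliary (weight-4 telescope): `soloInformedZ4Datum_i`. -/
@[simp] theorem soloInformedZ4Datum_i : soloInformedZ4Datum.i = 0 := rfl
/-- Auxiliary (weight-4 telescope): `soloInformedZ4Datum_D`. -/
@[simp] theorem soloInformedZ4Datum_D : soloInformedZ4Datum.D = soloInformedOpenCube 4 := rfl
/-- Auxiliary (weight-4 telescope): `soloInformedZ4Datum_Q`. -/
@[simp] theorem soloInformedZ4Datum_Q : soloInformedZ4Datum.Q = soloInformedZ4Q := rfl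
/-- Auxiliary (weight-4 telescope): `soloInformedZ4Datum_Ω`. -/
@[simp] theorem soloInformedZ4Datum_Ω : soloInformedZ4Datum.Ω = soloInformedZ4Ω := rfl
/-- Auxiliary (weight-4 telescope): `soloInformedZ4Datum_C`. -/
@[simp] theorem soloInformedZ4Datum_C : soloInformedZ4Datum.C = 1 := rfl

/-- Auxiliary (weight-4 telescope): `soloInformedZ4_R1_domain`. -/
theorem soloInformedZ4_R1_domain :
    soloInformedZ4Datum.R1.domain = soloInformedOpenCube 4 ∩ {x | x 3 < x 0} := by
  rw [SoloInformedTelDatum.R1_domain]; ext x; simp [SoloInformedTelDatum.ω]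

/-- Auxiliary (weight-4 telescope): `soloInformedZ4_R1_integrand`. -/
theorem soloInformedZ4_R1_integrand (x : Fin 4 → ℝ) :
    soloInformedZ4Datum.R1.integrand x = 1 / ((1 - x 1 * x 2 * x 0) * (1 - x 3)) := by
  rw [SoloInformedTelDatum.R1_integrand]; exact soloInformed_Z4F1_eq x

/-- Auxiliary (weight-4 telescope): `soloInformedZ4_R2_domain`. -/
theorem soloInformedZ4_R2_domain : soloInformedZ4Datum.R2.domain = soloInformedOpenCube 4 := rfl

/-- Auxiliary (weight-4 telescope): `soloInformedZ4_R2_integrand`. -/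
theorem soloInformedZ4_R2_integrand (x : Fin 4 → ℝ) :
    soloInformedZ4Datum.R2.integrand x = 1 / ((1 - x 1 * x 2 * x 0) * (1 - x 1 * x 2 * x 0 * x 3)) := by
  rw [SoloInformedTelDatum.R2_integrand]; exact soloInformed_Z4FS_eq x

end Summit.KontsevichZagierPeriods.KontsevichZagierPeriods.Theorems
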